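import Literature.NumberTheory.GaloisCohomology.PoitouTateRestrictedShaReadoutSkeleton
import Literature.Algebra.Homology.ExtDualityPairing
import Mathlib.Algebra.Homology.DerivedCategory.Ext.ExactSequences
import HarnessLib

/-!
# The `S`-restricted `Ш`-pairing on MILNE'S `Ext` ROAD (finite `S`): the readout skeleton instantiated with
# `E = Ext¹(A, C̄_S)`, `Ψ = ∂ : Ext¹(A, C̄_S) → Ext²(A, Ē_S) ≅ H²(G_S, A^D)` (Milne I Thm. 4.10 (a), proof p. 58)

Topic `NumberTheory/GaloisCohomology`; namespace `Literature.NumberTheory.GaloisCohomology.ShaExtRoad`.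
Definitions WITH BODIES (`idelePart`, `read`, `obstruction` — the three maps of the skeleton on the
`Ext` road) and theorems; no named fact, no `sorry`, no instance, no notation.  Lane «PT-Ш-S-TC» of cell
`bsd-eis` (crux `GoodLatticeBDPValue`), brick D5 on route (ii) of `D4A-DESIGN-w7g11.md` §2.

THE MATHEMATICS (Milne, *ADT* I, proof of Thm. 4.10 p. 58; Harari §17.5).  Apply `Extʳ_{G_S}(A, ·)` to
the class-formation sequence `T : 0 → Ē_S → J̄_S → C̄_S → 0`:
`Ext¹(A, J̄_S) → Ext¹(A, C̄_S) →∂ Ext²(A, Ē_S) → Ext²(A, J̄_S)`.  With `Ext²(A, Ē_S) ≅ H²(G_S, A^D)`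
(`cmp`, Harari 17.21 (a)) and `Ext²(A, J̄_S) ≅ ⊕_{v ∈ S} H²(K_v, ·)` one gets `Ш²_S(K, A^D) = im ∂ ≅
Ext¹(A, C̄_S) / im Ext¹(A, J̄_S)`, and Tate duality `α¹ : Ext¹(A, C̄_S) ≅ Ext¹(ℤ, A)^* = H¹(G_S, A)^*`
(`inv`, `nat`) pairs it with `Ш¹_S(K, A)`.  In the skeleton of `PoitouTateRestrictedShaReadoutSkeleton`:
`E := Ext¹(A, CS)`, `EJ := Ext¹(A, JS)`, `j := (· ≫ g)`, `α x := inv (nat · ∘ x)`, `Ψ := cmp ∘ ∂`,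
with the module `M` on the `Ш²` side such that `H²(G_S, M^{N_S})` is the target of `cmp` and
`H¹(G_S, M^D)` the source of `nat` (so `A` "is" `M^D`).  This file proves the skeleton's LINEAR-ALGEBRA
hypotheses from homological ones — `Ψ ∘ j = 0` and `ker Ψ ⊆ im j` from the EXACTNESS of the `Ext`
sequence (`obstruction_idelePart`, `exists_idelePart_of_obstruction_eq_zero`; no class groups `Cl_S`
intervene, unlike on the presentation road), `ker α ⊆ ker Ψ` and `α` onto from `α¹` bijective and `nat`
bijective — and records the resulting **`pairing_perfect`** and **`pairing_natural`** (for an adjoint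
pair `(F, G)`, `θ := (G ≫ ·)` on `Ext¹(·, CS)`; the two pointwise inputs are the naturality of `cmp`
(`hcmpG`) and of `nat` (`hnatG`)).  Remaining displayed inputs (other bricks): the sequence `T` in the
chosen category (D1/D3), `inv` with `α¹` bijective (D0/D2), `nat` (F1 for `G_S`), `cmp` injective and
natural (D4a-1), the readouts with (R3)/(R4) (D4b), and `Ψ(E) = Ш²_S` (`hΨsha`, `hΨsurj`: local–global).

HONEST FRAMING: a reduction with displayed hypotheses; no case of Poitou–Tate duality and nothing about
BSD is proved here.  AI formalisation, weaker than expert review; established only by the kernel check.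

## References
* J. S. Milne, *Arithmetic Duality Theorems*, 2nd ed. (2006), I Thm. 4.10 (a), proof p. 58, Lemma 4.12,
  Lemma 4.13. [MilneADT2006]
* D. Harari, *Galois Cohomology and Class Field Theory* (2020), §16.2–16.3, Lemma 17.21, Prop. 17.25,
  §17.5 (p. 302). [Harari2020]
-/

noncomputable section

open Function NumberField IsDedekindDomain CategoryTheory CategoryTheory.Abelian
open scoped NumberField

universe w v u

namespace Literature.NumberTheory.GaloisCohomology

open Literature.NumberTheory.GaloisRepresentations
open Literature.NumberTheory.GaloisRepresentations.DiscreteGaloisModule (TateDual tateDual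
  restrictedCohomology restrictedLocalization shaRestricted localTatePairingZMod)
open Literature.Algebra.Homology Literature.Algebra.Homology.ExtDuality
open Literature.AnabelianGeometry.AbsoluteAnabelian.Prop121vii (zmodToQmodZ zmodToQmodZ_injective)

namespace ShaExtRoad

variable {K : Type} [Field K] [NumberField K] {M : Type} [AddCommGroup M] [TopologicalSpace M]
  [DiscreteTopology M] [Finite M] {n : ℕ} [NeZero n]
  (ρ : DiscreteGaloisModule K M) (S : Set (HeightOneSpectrum (𝓞 K)))
  {𝒞 : Type u} [Category.{v} 𝒞] [Abelian 𝒞] [HasExt.{w} 𝒞]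
  {T : ShortComplex 𝒞} (hT : T.ShortExact) (A P : 𝒞)
  (inv : Ext P T.X₃ 2 →+ AddCircle (1 : ℚ))
  (nat : restrictedCohomology (ρ.tateDual n) S 1 →+ Ext P A 1)
  (cmp : Ext A T.X₁ 2 →+ restrictedCohomology ρ S 2)

/-! ## §1 The three maps of the skeleton on the `Ext` road -/

omit [NumberField K] [NeZero n] in
/-- `j : Ext¹(A, J̄_S) → Ext¹(A, C̄_S)`, post-composition with `g : J̄_S ⟶ C̄_S` (the "idèle part").
[cite: Harari2020, §17.5] -/
def idelePart : Ext A T.X₂ 1 →+ Ext A T.X₃ 1 := (Ext.mk₀ T.g).postcomp A (add_zero 1)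

/-- `α : Ext¹(A, C̄_S) → Hom(H¹(G_S, M^D), ℚ/ℤ)`, `x ↦ (y ↦ inv (nat y ∘ x))` — Tate's `α¹(A)` read through
the bridge `nat`. [cite: Harari2020, §16.3] -/
def read : Ext A T.X₃ 1 →+ (restrictedCohomology (ρ.tateDual n) S 1 →+ AddCircle (1 : ℚ)) :=
  AddMonoidHom.mk' (fun x => (ExtDuality.adjointMap (P := P) inv A (rfl : 1 + 1 = 2) x).comp nat)
    (fun x x' => by rw [map_add, AddMonoidHom.add_comp])

omit [NumberField K] [NeZero n] in
/-- Formula: `read x y = inv (nat y ∘ x)`. [cite: Harari2020, §16.3] -/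
theorem read_apply (x : Ext A T.X₃ 1) (y : restrictedCohomology (ρ.tateDual n) S 1) :
    read ρ S A P inv nat x y = inv ((nat y).comp x (rfl : 1 + 1 = 2)) := rfl

omit [NumberField K] [Finite M] in
/-- `Ψ : Ext¹(A, C̄_S) → H²(G_S, M^{N_S})`, the connecting map `∂ : Ext¹(A, C̄_S) → Ext²(A, Ē_S)` of
`T` followed by the comparison `cmp : Ext²(A, Ē_S) → H²(G_S, ·)`. [cite: MilneADT2006, I Thm. 4.10 (a) (proof, p. 58)] -/
def obstruction : Ext A T.X₃ 1 →+ restrictedCohomology ρ S 2 :=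
  cmp.comp (hT.extClass.postcomp A (rfl : 1 + 1 = 2))

omit [NumberField K] [Finite M] in
/-- Formula: `obstruction x = cmp (x ∘ [T])`. [cite: MilneADT2006, I Thm. 4.10 (a) (proof, p. 58)] -/
theorem obstruction_apply (x : Ext A T.X₃ 1) :
    obstruction ρ S hT A cmp x = cmp (x.comp hT.extClass (rfl : 1 + 1 = 2)) := rfl

/-! ## §2 The skeleton's hypotheses from exactness and duality -/

omit [NumberField K] [Finite M] in
/-- **`Ψ ∘ j = 0`**: `(f ≫ g) ∘ [T] = f ∘ (g ∘ [T]) = 0`. [cite: Harari2020, §17.5] -/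
theorem obstruction_idelePart (f : Ext A T.X₂ 1) :
    obstruction ρ S hT A cmp (idelePart A f) = 0 := by
  rw [obstruction_apply]
  change cmp (((f.comp (Ext.mk₀ T.g) (add_zero 1))).comp hT.extClass (rfl : 1 + 1 = 2)) = 0
  rw [Ext.comp_assoc_of_second_deg_zero, hT.comp_extClass, Ext.comp_zero, map_zero]

omit [NumberField K] [Finite M] in
/-- **`ker Ψ ⊆ im j`** when `cmp` is injective: exactness of `Ext¹(A, J̄_S) → Ext¹(A, C̄_S) → Ext²(A, Ē_S)`.
[cite: Harari2020, §17.5] -/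
theorem exists_idelePart_of_obstruction_eq_zero (hcmp : Injective cmp) (x : Ext A T.X₃ 1)
    (hx : obstruction ρ S hT A cmp x = 0) : ∃ f : Ext A T.X₂ 1, x = idelePart A f := by
  have h0 : x.comp hT.extClass (rfl : 1 + 1 = 2) = 0 := hcmp (by rw [← obstruction_apply, hx, map_zero])
  obtain ⟨f, hf⟩ := Ext.covariant_sequence_exact₃ A hT x (rfl : 1 + 1 = 2) h0
  exact ⟨f, hf.symm⟩

omit [NumberField K] [NeZero n] in
/-- **`ker α ⊆ ker Ψ`** (indeed `α` is injective) when `α¹(A)` is injective and `nat` is onto.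
[cite: Harari2020, §16.3] -/
theorem read_injective (hα : Injective (ExtDuality.adjointMap (P := P) inv A (rfl : 1 + 1 = 2)))
    (hnat : Surjective nat) : Injective (read ρ S A P inv nat) := fun _ _ h =>
  hα ((AddMonoidHom.cancel_right hnat).1 h)

omit [NumberField K] [NeZero n] in
/-- **`α` is onto the characters of `H¹(G_S, M^D)`** when `α¹(A)` is onto and `nat` is bijective.
[cite: Harari2020, §16.3] -/
theorem read_surjective (hα : Surjective (ExtDuality.adjointMap (P := P) inv A (rfl : 1 + 1 = 2)))
    (hnat : Bijective nat) : Surjective (read ρ S A P inv nat) := by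
  intro Φ
  let natE : restrictedCohomology (ρ.tateDual n) S 1 ≃+ Ext P A 1 := AddEquiv.ofBijective nat hnat
  obtain ⟨x, hx⟩ := hα (Φ.comp natE.symm.toAddMonoidHom)
  refine ⟨x, AddMonoidHom.ext fun y => ?_⟩
  change ExtDuality.adjointMap (P := P) inv A (rfl : 1 + 1 = 2) x (nat y) = Φ y
  rw [hx]
  change Φ (natE.symm (natE y)) = Φ y
  rw [AddEquiv.symm_apply_apply]

/-! ## §3 Perfectness and naturality on the `Ext` road -/

variable (Sig : Finset (Place K)) (linv : LocalInvariants K n)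
  (R : ∀ v : Place K, Ext A T.X₂ 1 →+ galoisCohomology (ρ.toLocal v) 1)

/-- **Milne I Thm. 4.10 (a) for `G_S`, `S` finite, on the `Ext` road**: `Ш²_S(K, M)` is finite and the
skeleton pairing `ShaReadout.pairing` built from `(j, α, Ψ) = (idelePart, read, obstruction)` has both
adjoints bijective, given: `α¹(A)` bijective (Tate duality), `nat` bijective, `cmp` injective, (R3)/(R4) for
the readouts of `Ext¹(A, J̄_S)`, and `Ψ(E) = Ш²_S` (`hΨsha`, `hΨsurj`).
[cite: MilneADT2006, I Thm. 4.10 (a) (proof, p. 58)] [cite: Harari2020, Thm. 17.13 (b), §17.5] -/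
theorem pairing_perfect (hM : ∀ m : M, n • m = 0)
    (hSig₁ : ∀ w : InfinitePlace K, (Sum.inl w : Place K) ∈ Sig)
    (hSig₂ : ∀ v : HeightOneSpectrum (𝓞 K), (Sum.inr v : Place K) ∈ Sig ↔ v ∈ S)
    (hperf : linv.IsPerfect)
    (harch : ∀ (w : InfinitePlace K) (Φ : galoisCohomology ((ρ.tateDual n).toLocal (Sum.inl w)) 1 →+ ZMod n),
      ∃ t : galoisCohomology (ρ.toLocal (Sum.inl w)) 1,
        ∀ x, Φ x = localTatePairingZMod ρ n (Sum.inl w) (linv (Sum.inl w)) t x)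
    [Finite ↥(shaRestricted (ρ.tateDual n) S 1)]
    (hα : Bijective (ExtDuality.adjointMap (P := P) inv A (rfl : 1 + 1 = 2)))
    (hnat : Bijective nat) (hcmp : Injective cmp)
    (hR3 : ∀ t : Π v : Place K, galoisCohomology (ρ.toLocal v) 1,
      ∃ f : Ext A T.X₂ 1, ∀ v ∈ Sig, R v f = t v)
    (hR4 : ∀ (f : Ext A T.X₂ 1) (y : restrictedCohomology (ρ.tateDual n) S 1),
      read ρ S A P inv nat (idelePart A f) y =
        zmodToQmodZ n (∑ v ∈ Sig, localTatePairingZMod ρ n v (linv v) (R v f)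
          (restrictedLocalization (ρ.tateDual n) S v 1 y)))
    (hΨsha : ∀ x : Ext A T.X₃ 1, obstruction ρ S hT A cmp x ∈ shaRestricted ρ S 2)
    (hΨsurj : ∀ c ∈ shaRestricted ρ S 2, ∃ x : Ext A T.X₃ 1, obstruction ρ S hT A cmp x = c) :
    Finite ↥(shaRestricted ρ S 2) ∧
      Bijective (ShaReadout.pairing ρ S Sig linv (idelePart A) (read ρ S A P inv nat)
        (obstruction ρ S hT A cmp) R hSig₂ hR4
        (exists_idelePart_of_obstruction_eq_zero ρ S hT A cmp hcmp) hΨsurj) ∧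
      Bijective (ShaReadout.pairing ρ S Sig linv (idelePart A) (read ρ S A P inv nat)
        (obstruction ρ S hT A cmp) R hSig₂ hR4
        (exists_idelePart_of_obstruction_eq_zero ρ S hT A cmp hcmp) hΨsurj).flip :=
  ShaReadout.pairing_perfect ρ S Sig linv (idelePart A) (read ρ S A P inv nat)
    (obstruction ρ S hT A cmp) R hM hSig₁ hSig₂ hperf harch hR3 hR4
    (obstruction_idelePart ρ S hT A cmp) (exists_idelePart_of_obstruction_eq_zero ρ S hT A cmp hcmp)
    hΨsha hΨsurj (fun x x' h => by rw [read_injective ρ S A P inv nat hα.1 hnat.2 h])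
    (read_surjective ρ S A P inv nat hα.2 hnat)

/-- **Naturality on the `Ext` road** (clause (N)): for a second module `M'` (level `n'`) run on the same
`T`, `P`, `inv` with object `A'`, bridge `nat'`, comparison `cmp'`, and a morphism `G : A' ⟶ A` (the
adjoint `M'^D → M^D` of `F : M → M'` in the presented world) such that the comparisons intertwine
`G^*` on `Ext²(·, Ē_S)` with `F_*` on `H²(G_S, ·)` at the lift of `c` (`hcmpG`, pointwise: "`x' = F_* c`")
and the bridges intertwine `G` (`hnatG`: `nat z = nat' z' ∘ G`, "`z = G_* z'`"), one has
`B'(x', z') = B(c, z)` — `θ := (G ≫ ·)` in `ShaReadout.pairing_natural`, the Yoneda pairing being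
natural (`Ext.comp` associativity). [cite: MilneADT2006, I Thm. 4.10 (a) and §4 p. 65] [cite: Harari2020, §16.2 (16.4)] -/
theorem pairing_natural
    {M' : Type} [AddCommGroup M'] [TopologicalSpace M'] [DiscreteTopology M'] [Finite M'] {n' : ℕ} [NeZero n']
    (ρ' : DiscreteGaloisModule K M') (A' : 𝒞)
    (nat' : restrictedCohomology (ρ'.tateDual n') S 1 →+ Ext P A' 1)
    (cmp' : Ext A' T.X₁ 2 →+ restrictedCohomology ρ' S 2)
    (linv' : LocalInvariants K n')
    (R' : ∀ v : Place K, Ext A' T.X₂ 1 →+ galoisCohomology (ρ'.toLocal v) 1)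
    (hSig₂ : ∀ v : HeightOneSpectrum (𝓞 K), (Sum.inr v : Place K) ∈ Sig ↔ v ∈ S)
    (hcmp : Injective cmp) (hcmp' : Injective cmp')
    (hR4 : ∀ (f : Ext A T.X₂ 1) (y : restrictedCohomology (ρ.tateDual n) S 1),
      read ρ S A P inv nat (idelePart A f) y =
        zmodToQmodZ n (∑ v ∈ Sig, localTatePairingZMod ρ n v (linv v) (R v f)
          (restrictedLocalization (ρ.tateDual n) S v 1 y)))
    (hΨsurj : ∀ c ∈ shaRestricted ρ S 2, ∃ x : Ext A T.X₃ 1, obstruction ρ S hT A cmp x = c)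
    (hR4' : ∀ (f : Ext A' T.X₂ 1) (y : restrictedCohomology (ρ'.tateDual n') S 1),
      read ρ' S A' P inv nat' (idelePart A' f) y =
        zmodToQmodZ n' (∑ v ∈ Sig, localTatePairingZMod ρ' n' v (linv' v) (R' v f)
          (restrictedLocalization (ρ'.tateDual n') S v 1 y)))
    (hΨsurj' : ∀ c ∈ shaRestricted ρ' S 2, ∃ x : Ext A' T.X₃ 1, obstruction ρ' S hT A' cmp' x = c)
    (G : A' ⟶ A) (c : ↥(shaRestricted ρ S 2)) (x' : ↥(shaRestricted ρ' S 2))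
    (hcmpG : ∀ x : Ext A T.X₃ 1, obstruction ρ S hT A cmp x = c →
      cmp' (((Ext.mk₀ G).comp x (zero_add 1)).comp hT.extClass (rfl : 1 + 1 = 2)) = x')
    (z' : ↥(shaRestricted (ρ'.tateDual n') S 1)) (z : ↥(shaRestricted (ρ.tateDual n) S 1))
    (hnatG : nat (z : restrictedCohomology (ρ.tateDual n) S 1) =
      (nat' (z' : restrictedCohomology (ρ'.tateDual n') S 1)).comp (Ext.mk₀ G) (add_zero 1)) :
    ShaReadout.pairing ρ' S Sig linv' (idelePart A') (read ρ' S A' P inv nat')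
        (obstruction ρ' S hT A' cmp') R' hSig₂ hR4'
        (exists_idelePart_of_obstruction_eq_zero ρ' S hT A' cmp' hcmp') hΨsurj' x' z' =
      ShaReadout.pairing ρ S Sig linv (idelePart A) (read ρ S A P inv nat)
        (obstruction ρ S hT A cmp) R hSig₂ hR4
        (exists_idelePart_of_obstruction_eq_zero ρ S hT A cmp hcmp) hΨsurj c z := by
  refine ShaReadout.pairing_natural ρ S Sig linv (idelePart A) (read ρ S A P inv nat)
    (obstruction ρ S hT A cmp) R ρ' linv' (idelePart A') (read ρ' S A' P inv nat')
    (obstruction ρ' S hT A' cmp') R' hSig₂ hR4 _ hΨsurj hR4' _ hΨsurj'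
    (fun x => (Ext.mk₀ G).comp x (zero_add 1)) c x' z' z (fun x hx => ?_) (fun x _ => ?_)
  · rw [obstruction_apply]
    exact hcmpG x hx
  · rw [read_apply, read_apply, hnatG, Ext.comp_assoc_of_second_deg_zero]

end ShaExtRoad

end Literature.NumberTheory.GaloisCohomology

end
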